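import Summits.BirchSwinnertonDyer.Rank1Residual.X11b.BDPRouteLocalNonsingularBridge
import Literature.NumberTheory.EllipticCurves.TateNormalFormUnramifiedComponentsProofs
import HarnessLib

/-!
# Class X11b, route p2: the subgroup `M₀ = E₀(K_v^{nr})^{alg} ≤ E(K̄)^{I_v}` of points with
# non-singular reduction — definition, `D_v`-stability, finite index (Kodaira–Néron)
# (cell `b2b-bsdres`, sub-cell `multr1-p2`, gen 14)

HONEST FRAMING (verbatim, cell `b2b-bsdres`): the goal of the cell is to DELETE the
COMBINATION-SHAPED residual classes for ALL analytic-rank `≤ 1` curves over `ℚ` — "full BSD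
formula for every rank `≤ 1` curve in class `C`" assembled STRICTLY from published theorems — so
that the rank-`≤ 1` remainder becomes exactly the CONSTRUCTION-SHAPED classes, which are TYPED
(missing-input Props), NOT attempted; this is not "finishing BSD". Research route `p2` for class
X11b; no claim beyond the stated class; nothing booked; X11b stays CONSTRUCTION-SHAPED. One
definition with a body (`nonsingularPart`) and theorems; no named fact; no `sorry`.

## Content

The subgroup `M₀` of `BDPRouteLocalKernelInertiaBound` is made explicit. Data (all existing in the
tree, quantified here as arguments so that no choice is hidden in the definition): the minimal
model `X = M ⊗ K_v` at `v` (`M = W.localMinimalIntegralModel v`), the spectral valuation `w = |·|_v`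
on `K̄_v`, an `𝒪_w`-equation `W₀` with `X ⊗ K̄_v = W₀ ⊗ K̄_v` (`IsIntegral.integral`), and an
equivariant transport `Φ : E(K̄_v) ≃ X(K̄_v)` (`exists_addEquiv_localPoints_of_smul_eq`). Then

  `F = Φ ∘ ι_* : E(K̄)^{I_v} → X(K̄_v)`  (`ι = closureEmb K_v`, `pointsMapOfEmb`),
  `nonsingularPart = F⁻¹(E₀)`,  `E₀ = {Q ∈ X(K̄_v) : Q has non-singular reduction on W₀}`

(Silverman's `E₀(K_v^{nr})`, *AEC* VII.§2 and the proof of VII.6.2 over `K^nr`; the points of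
`E(K̄)^{I_v}` are the algebraic points of `E(K_v^{nr})`).

* `mem_nonsingularPart_iff`, `mem_nonsingularPart_iff_reducesToNonsingular` — membership.
* `map_inertia_transport_eq` — `F` lands in the `I_𝔐`-fixed points (`I_𝔐 ≤ Γ_{K_v}` the local
  inertia group; local inertia restricts into `I_v`: `resGalOfEmb_mem_inertia_primeBelow` and
  `primeBelow_closureEmb_eq_adicCompletionPrime`).
* **`smul_mem_nonsingularPart`** (g1) — `M₀` is stable under `D_v` (every `g ∈ D_v` is `res_ι σ`,
  `σ ∈ Γ_{K_v}` an isometry of `|·|_v`, and `E₀` is stable under isometric automorphisms: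
  tree `reducesToNonsingular_map_iff_of_forall_eq`); `inertiaSubOne_mem_nonsingularPart`.
* **`finiteIndex_nonsingularPart`** (g2) — `M₀` has finite index in `E(K̄)^{I_v}`: the quotient
  embeds into `X(K_v^{nr})/E₀(K_v^{nr})`, finite by Kodaira–Néron over `K_v^{nr}` (tree
  `kodairaNeron_exists_finset_reducesToNonsingular_holds`, Silverman *AEC* Cor. VII.6.2).

The index `[E(K̄)^{D_v} : E(K̄)^{D_v} ⊓ M₀] ∣ c_v` (g4), the finiteness of the `D_v`-fixed `p`-power
torsion, and the transport of divisibility are in the continuation files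
`BDPRouteNonsingularPartIndex.lean` / `BDPRouteNonsingularPartDivisible.lean`.
CONDITIONAL use only; nothing booked; reach and labels unchanged.

References: [SilvermanAEC2009] VII.§2 (E₀, E₁, Prop. VII.2.1), Thm. VII.6.1 / Cor. VII.6.2, proof
of Thm. VII.7.1 (over `K^nr`), VIII.§1; [GreenbergLNM1716] §3 Lemma 3.3 (p. 87), §4 p. 74;
[NeukirchANT1999] II §9 (9.6).
-/

noncomputable section

open scoped Classical NNReal

open NumberField IsDedekindDomain Field IsDedekindDomain.HeightOneSpectrum WeierstrassCurve
open Literature.NumberTheory.EllipticCurves Literature.NumberTheory.EllipticCurves.GreenbergSelmer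
open Literature.NumberTheory.GaloisRepresentations

universe u

namespace Summit.BirchSwinnertonDyer.Rank1Residual.X11b.AcSelmer

variable {K : Type u} [Field K] [NumberField K] (W : WeierstrassCurve K) {v : HeightOneSpectrum (𝓞 K)}
  {w : Valuation (AlgebraicClosure (v.adicCompletion K)) ℝ≥0}

/-! ## The subgroup `M₀ = F⁻¹(E₀)` -/

section Defn

/-- **`M₀ = E₀(K_v^{nr})^{alg}`, the points of `E(K̄)^{I_v}` with non-singular reduction at `v`.**
Data: the spectral valuation `w` on `K̄_v` (through its valuation ring `𝒪_w = w.integer`), an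
`𝒪_w`-equation `W₀` with `X ⊗ K̄_v = W₀ ⊗ K̄_v` for the minimal model `X = M ⊗ K_v` at `v`
(`M = W.localMinimalIntegralModel v`), and a transport `Φ : E(K̄_v) ≃ X(K̄_v)`. Definition: the
preimage under `F = Φ ∘ ι_*` (`ι = closureEmb K_v`) of the subgroup of `X(K̄_v) = W₀(K̄_v)` of points
with non-singular reduction on `W₀` (`ReductionHomomorphism.nonsingularReductionSubgroup`).
Silverman's `E₀` over `K^nr`. [cite: SilvermanAEC2009, VII.§2 (definition of `E₀`, PDF p. 167) and proof of Thm. VII.7.1 (`E₀(K^nr)`)] -/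
def nonsingularPart {W₀ : WeierstrassCurve w.integer}
    (hW₀ : ((W.localMinimalIntegralModel v).map (algebraMap (v.adicCompletionIntegers K)
        (v.adicCompletion K))).baseChange (AlgebraicClosure (v.adicCompletion K)) =
      W₀.baseChange (AlgebraicClosure (v.adicCompletion K)))
    (Φ : localPoints W (v.adicCompletion K) ≃+
      (((W.localMinimalIntegralModel v).map (algebraMap (v.adicCompletionIntegers K)
        (v.adicCompletion K))).baseChange (AlgebraicClosure (v.adicCompletion K))).toAffine.Point) :
    AddSubgroup ↥(FixedPoints.addSubgroup
      ↥((adicCompletionPrime K v).inertia (absoluteGaloisGroup K)) W.geomPoints) :=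
  ((W₀.nonsingularReductionSubgroup (Valuation.integer.integers w)).comap
    (Affine.Point.congrEquiv hW₀).toAddMonoidHom).comap
    (Φ.toAddMonoidHom.comp ((pointsMapOfEmb W (closureEmb (K := K) (v.adicCompletion K))).comp
      (FixedPoints.addSubgroup ↥((adicCompletionPrime K v).inertia (absoluteGaloisGroup K))
        W.geomPoints).subtype))

variable {W}
variable {W₀ : WeierstrassCurve w.integer}
  {hW₀ : ((W.localMinimalIntegralModel v).map (algebraMap (v.adicCompletionIntegers K)
      (v.adicCompletion K))).baseChange (AlgebraicClosure (v.adicCompletion K)) =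
    W₀.baseChange (AlgebraicClosure (v.adicCompletion K))}
  {Φ : localPoints W (v.adicCompletion K) ≃+
    (((W.localMinimalIntegralModel v).map (algebraMap (v.adicCompletionIntegers K)
      (v.adicCompletion K))).baseChange (AlgebraicClosure (v.adicCompletion K))).toAffine.Point}

/-- Membership in `M₀`: `F P = Φ (ι_* P)` has non-singular reduction on `W₀`. [folklore] -/
theorem mem_nonsingularPart_iff
    (P : FixedPoints.addSubgroup ↥((adicCompletionPrime K v).inertia (absoluteGaloisGroup K))
      W.geomPoints) :
    P ∈ nonsingularPart W hW₀ Φ ↔ W₀.HasNonsingularReduction (Affine.Point.congrEquiv hW₀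
      (Φ (pointsMapOfEmb W (closureEmb (K := K) (v.adicCompletion K)) (P : W.geomPoints)))) :=
  Iff.rfl

/-- Membership in `M₀` in the language of `KodairaNeronUnramified` (`ReducesToNonsingular` for the
residue map of `𝒪_w`). [folklore] -/
theorem mem_nonsingularPart_iff_reducesToNonsingular
    (P : FixedPoints.addSubgroup ↥((adicCompletionPrime K v).inertia (absoluteGaloisGroup K))
      W.geomPoints) :
    P ∈ nonsingularPart W hW₀ Φ ↔ ReducesToNonsingular w (IsLocalRing.residue w.integer)
      (Φ (pointsMapOfEmb W (closureEmb (K := K) (v.adicCompletion K)) (P : W.geomPoints))) := by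
  rw [mem_nonsingularPart_iff, ← reducesToNonsingular_iff_hasNonsingularReduction W₀,
    reducesToNonsingular_congrEquiv_iff _ hW₀]

end Defn

/-! ## `F` lands in `X(K_v^{nr}) = X(K̄_v)^{I_𝔐}`; `D_v`-stability of `M₀` -/

section Stability

variable {W}
variable (hw : ∀ x, (w x : ℝ) =
    spectralNorm (v.adicCompletion K) (AlgebraicClosure (v.adicCompletion K)) x)
  {W₀ : WeierstrassCurve w.integer}
  (hW₀ : ((W.localMinimalIntegralModel v).map (algebraMap (v.adicCompletionIntegers K)
      (v.adicCompletion K))).baseChange (AlgebraicClosure (v.adicCompletion K)) =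
    W₀.baseChange (AlgebraicClosure (v.adicCompletion K)))
  {Φ : localPoints W (v.adicCompletion K) ≃+
    (((W.localMinimalIntegralModel v).map (algebraMap (v.adicCompletionIntegers K)
      (v.adicCompletion K))).baseChange (AlgebraicClosure (v.adicCompletion K))).toAffine.Point}
  (hΦ : ∀ (σ : absoluteGaloisGroup (v.adicCompletion K)) (Q : localPoints W (v.adicCompletion K)),
    Φ (σ • Q) = Affine.Point.map ((absoluteGaloisGroup.toAlgEquiv _ σ :
        AlgebraicClosure (v.adicCompletion K) ≃ₐ[v.adicCompletion K]
          AlgebraicClosure (v.adicCompletion K)) :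
        AlgebraicClosure (v.adicCompletion K) →ₐ[v.adicCompletion K]
          AlgebraicClosure (v.adicCompletion K)) (Φ Q))

include hΦ in
/-- **Equivariance of `F = Φ ∘ ι_*`**: `F (res_ι σ • P) = σ • F P` for `σ ∈ Γ_{K_v}`. [folklore] -/
theorem transport_pointsMapOfEmb_smul (σ : absoluteGaloisGroup (v.adicCompletion K))
    (P : W.geomPoints) :
    Φ (pointsMapOfEmb W (closureEmb (K := K) (v.adicCompletion K))
        (resGalOfEmb (closureEmb (K := K) (v.adicCompletion K)) σ • P)) =
      Affine.Point.map ((absoluteGaloisGroup.toAlgEquiv _ σ :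
          AlgebraicClosure (v.adicCompletion K) ≃ₐ[v.adicCompletion K]
            AlgebraicClosure (v.adicCompletion K)) :
          AlgebraicClosure (v.adicCompletion K) →ₐ[v.adicCompletion K]
            AlgebraicClosure (v.adicCompletion K))
        (Φ (pointsMapOfEmb W (closureEmb (K := K) (v.adicCompletion K)) P)) := by
  rw [pointsMapOfEmb_smul, hΦ]

include hΦ in
/-- **`F` lands in `X(K_v^{nr})`**: for `P ∈ E(K̄)^{I_v}` and `σ` in the inertia group `I_𝔐 ≤ Γ_{K_v}`
of a prime `𝔐` of `\bar 𝓞_v` above `𝓂_v`, `σ • F P = F P` — local inertia restricts into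
`I_v = I_{𝔓₀}`, `𝔓₀ = 𝔓_{ι,𝔐}` (tree `resGalOfEmb_mem_inertia_primeBelow`,
`primeBelow_closureEmb_eq_adicCompletionPrime`). [cite: NeukirchANT1999, Ch. II §9 Prop. (9.6)] -/
theorem map_inertia_transport_eq {𝔐 : Ideal v.localAbsIntegers} (h𝔐 : 𝔐 ∈ v.localPrimesAbove)
    (P : FixedPoints.addSubgroup ↥((adicCompletionPrime K v).inertia (absoluteGaloisGroup K))
      W.geomPoints)
    {σ : absoluteGaloisGroup (v.adicCompletion K)}
    (hσ : σ ∈ 𝔐.inertia (absoluteGaloisGroup (v.adicCompletion K))) :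
    Affine.Point.map ((absoluteGaloisGroup.toAlgEquiv _ σ :
        AlgebraicClosure (v.adicCompletion K) ≃ₐ[v.adicCompletion K]
          AlgebraicClosure (v.adicCompletion K)) :
        AlgebraicClosure (v.adicCompletion K) →ₐ[v.adicCompletion K]
          AlgebraicClosure (v.adicCompletion K))
      (Φ (pointsMapOfEmb W (closureEmb (K := K) (v.adicCompletion K)) (P : W.geomPoints))) =
      Φ (pointsMapOfEmb W (closureEmb (K := K) (v.adicCompletion K)) (P : W.geomPoints)) := by
  rw [← transport_pointsMapOfEmb_smul hΦ]
  congr 2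
  have hmem : resGalOfEmb (closureEmb (K := K) (v.adicCompletion K)) σ ∈
      (adicCompletionPrime K v).inertia (absoluteGaloisGroup K) := by
    rw [← primeBelow_closureEmb_eq_adicCompletionPrime v h𝔐]
    exact v.resGalOfEmb_mem_inertia_primeBelow (closureEmb (K := K) (v.adicCompletion K)) 𝔐 hσ
  exact P.2 ⟨_, hmem⟩

include hw hΦ in
/-- **(g1) `M₀` is stable under `D_v`.** For `g ∈ D_v` and `P ∈ M₀`, `g • P ∈ M₀`: `g = res_ι σ` with
`σ ∈ Γ_{K_v}` (`exists_eq_resGalOfEmb_of_mem_decomp`), `F (g • P) = σ • F P`, `σ` is an isometry of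
`|·|_v` (`spectralValuation_smul`), and the set of points with non-singular reduction is stable under
isometric `K_v`-automorphisms of `K̄_v` (tree `reducesToNonsingular_map_iff_of_forall_eq`).
[cite: SilvermanAEC2009, VII.§2 and VIII.§1 (Galois acts on `E₀`, reduction commutes with the decomposition group)] -/
theorem smul_mem_nonsingularPart [W.IsElliptic] {g : absoluteGaloisGroup K} (hg : g ∈ decomp v)
    {P : FixedPoints.addSubgroup ↥((adicCompletionPrime K v).inertia (absoluteGaloisGroup K))
      W.geomPoints}
    (hP : P ∈ nonsingularPart W hW₀ Φ) :
    (⟨g • (P : W.geomPoints), smul_mem_fixedPoints_inertia W.geomPoints hg P.2⟩ :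
      FixedPoints.addSubgroup ↥((adicCompletionPrime K v).inertia (absoluteGaloisGroup K))
        W.geomPoints) ∈ nonsingularPart W hW₀ Φ := by
  haveI := WeierstrassCurve.isIntegral_spectralValuation_baseChange hw (W.localMinimalIntegralModel v)
  obtain ⟨σ, rfl⟩ := exists_eq_resGalOfEmb_of_mem_decomp v hg
  rw [mem_nonsingularPart_iff_reducesToNonsingular] at hP ⊢
  change ReducesToNonsingular w (IsLocalRing.residue w.integer)
    (Φ (pointsMapOfEmb W (closureEmb (K := K) (v.adicCompletion K))
      (resGalOfEmb (closureEmb (K := K) (v.adicCompletion K)) σ • (P : W.geomPoints))))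
  rw [transport_pointsMapOfEmb_smul hΦ]
  exact (reducesToNonsingular_map_iff_of_forall_eq
    ((W.localMinimalIntegralModel v).map (algebraMap (v.adicCompletionIntegers K)
      (v.adicCompletion K))) _ (fun z ↦ spectralValuation_smul hw σ z) _).mpr hP

include hw hΦ in
/-- In particular `M₀` is stable under `φ − 1` for every `φ ∈ D_v` (the hypothesis `hM₀` of
`natCard_localKer_le_pow_padicValNat_relIndex_of_divisible`). [folklore] -/
theorem inertiaSubOne_mem_nonsingularPart [W.IsElliptic] {φ : absoluteGaloisGroup K}
    (hφD : φ ∈ decomp v)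
    {P : FixedPoints.addSubgroup ↥((adicCompletionPrime K v).inertia (absoluteGaloisGroup K))
      W.geomPoints}
    (hP : P ∈ nonsingularPart W hW₀ Φ) :
    inertiaSubOne W.geomPoints φ hφD P ∈ nonsingularPart W hW₀ Φ := by
  have h1 := smul_mem_nonsingularPart hw hW₀ hΦ hφD hP
  have e : inertiaSubOne W.geomPoints φ hφD P =
      (⟨φ • (P : W.geomPoints), smul_mem_fixedPoints_inertia W.geomPoints hφD P.2⟩ :
        FixedPoints.addSubgroup ↥((adicCompletionPrime K v).inertia (absoluteGaloisGroup K))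
          W.geomPoints) - P := Subtype.ext rfl
  rw [e]
  exact sub_mem h1 hP

end Stability

/-! ## (g2) Finite index: Kodaira–Néron over `K_v^{nr}` -/

section FiniteIndex

variable {W}
variable (hw : ∀ x, (w x : ℝ) =
    spectralNorm (v.adicCompletion K) (AlgebraicClosure (v.adicCompletion K)) x)
  {W₀ : WeierstrassCurve w.integer}
  (hW₀ : ((W.localMinimalIntegralModel v).map (algebraMap (v.adicCompletionIntegers K)
      (v.adicCompletion K))).baseChange (AlgebraicClosure (v.adicCompletion K)) =
    W₀.baseChange (AlgebraicClosure (v.adicCompletion K)))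
  {Φ : localPoints W (v.adicCompletion K) ≃+
    (((W.localMinimalIntegralModel v).map (algebraMap (v.adicCompletionIntegers K)
      (v.adicCompletion K))).baseChange (AlgebraicClosure (v.adicCompletion K))).toAffine.Point}
  (hΦ : ∀ (σ : absoluteGaloisGroup (v.adicCompletion K)) (Q : localPoints W (v.adicCompletion K)),
    Φ (σ • Q) = Affine.Point.map ((absoluteGaloisGroup.toAlgEquiv _ σ :
        AlgebraicClosure (v.adicCompletion K) ≃ₐ[v.adicCompletion K]
          AlgebraicClosure (v.adicCompletion K)) :
        AlgebraicClosure (v.adicCompletion K) →ₐ[v.adicCompletion K]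
          AlgebraicClosure (v.adicCompletion K)) (Φ Q))

include hw hΦ in
/-- **(g2) `M₀` has finite index in `E(K̄)^{I_v}` (Kodaira–Néron over `K_v^{nr}`).** The quotient
`E(K̄)^{I_v}/M₀` embeds (via `F`, which lands in the `I_𝔐`-fixed points) into the classes of
`X(K_v^{nr})` modulo points of non-singular reduction, of which there are finitely many: tree
`kodairaNeron_exists_finset_reducesToNonsingular_holds` (Silverman *AEC* Cor. VII.6.2 applied over
`K^nr`, as in the proof of Thm. VII.7.1: "`E(K^nr)/E₀(K^nr)` is finite"). [cite: SilvermanAEC2009, Cor. VII.6.2 (with Thm. VII.6.1), as applied over `K^nr` in the proof of Thm. VII.7.1] -/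
theorem finiteIndex_nonsingularPart [W.IsElliptic] : (nonsingularPart W hW₀ Φ).FiniteIndex := by
  -- notation
  let X := (W.localMinimalIntegralModel v).map (algebraMap (v.adicCompletionIntegers K)
    (v.adicCompletion K))
  haveI : X.IsElliptic := W.isElliptic_map_localMinimalIntegralModel (v := v)
  haveI : X.IsMinimal (v.adicCompletionIntegers K) := W.isMinimal_map_localMinimalIntegralModel (v := v)
  obtain ⟨𝔐, h𝔐⟩ := v.localPrimesAbove_nonempty
  let Fix := FixedPoints.addSubgroup ↥((adicCompletionPrime K v).inertia (absoluteGaloisGroup K))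
    W.geomPoints
  let M₀ : AddSubgroup Fix := nonsingularPart W hW₀ Φ
  let E₀ : AddSubgroup (X.baseChange (AlgebraicClosure (v.adicCompletion K))).toAffine.Point :=
    (W₀.nonsingularReductionSubgroup (Valuation.integer.integers w)).comap
      (Affine.Point.congrEquiv hW₀).toAddMonoidHom
  have hmemE₀ : ∀ Q, Q ∈ E₀ ↔ ReducesToNonsingular w (IsLocalRing.residue w.integer) Q := by
    intro Q
    change W₀.HasNonsingularReduction (Affine.Point.congrEquiv hW₀ Q) ↔ _
    rw [← reducesToNonsingular_iff_hasNonsingularReduction W₀, reducesToNonsingular_congrEquiv_iff _ hW₀]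
  let F : Fix →+ (X.baseChange (AlgebraicClosure (v.adicCompletion K))).toAffine.Point :=
    Φ.toAddMonoidHom.comp ((pointsMapOfEmb W (closureEmb (K := K) (v.adicCompletion K))).comp
      Fix.subtype)
  have hFapply : ∀ P : Fix, F P =
      Φ (pointsMapOfEmb W (closureEmb (K := K) (v.adicCompletion K)) (P : W.geomPoints)) :=
    fun _ ↦ rfl
  have hM₀F : ∀ P : Fix, P ∈ M₀ ↔ F P ∈ E₀ := fun _ ↦ Iff.rfl
  -- Kodaira–Néron over `K_v^{nr}`
  obtain ⟨T, -, hT⟩ := X.kodairaNeron_exists_finset_reducesToNonsingular_holds w hw h𝔐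
  -- the induced map on quotients is injective with finite range
  let g : Fix ⧸ M₀ → (X.baseChange (AlgebraicClosure (v.adicCompletion K))).toAffine.Point ⧸ E₀ :=
    QuotientAddGroup.map M₀ E₀ F fun x hx ↦ (hM₀F x).mp hx
  have hg : Function.Injective g := by
    intro a b hab
    induction a using QuotientAddGroup.induction_on with | H a => ?_
    induction b using QuotientAddGroup.induction_on with | H b => ?_
    have hab' : (QuotientAddGroup.mk (F a) : _ ⧸ E₀) = QuotientAddGroup.mk (F b) := hab
    rw [QuotientAddGroup.eq] at hab' ⊢
    rw [hM₀F, map_add, map_neg]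
    exact hab'
  have hrange : Set.range g ⊆
      (fun t ↦ (QuotientAddGroup.mk t : _ ⧸ E₀)) '' (T : Set _) := by
    rintro _ ⟨q, rfl⟩
    induction q using QuotientAddGroup.induction_on with | H P => ?_
    obtain ⟨t, ht, hPt⟩ := hT (F P) (fun σ hσ ↦ by
      rw [hFapply]; exact map_inertia_transport_eq hΦ h𝔐 P hσ)
    refine ⟨t, ht, ?_⟩
    change (QuotientAddGroup.mk t : _ ⧸ E₀) = QuotientAddGroup.mk (F P)
    rw [QuotientAddGroup.eq, hmemE₀, neg_add_eq_sub]
    exact hPt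
  haveI : Finite (Set.range g) := ((T.finite_toSet.image _).subset hrange).to_subtype
  haveI : Finite (Fix ⧸ M₀) := Finite.of_injective_finite_range hg
  exact AddSubgroup.finiteIndex_of_finite_quotient

end FiniteIndex

end Summit.BirchSwinnertonDyer.Rank1Residual.X11b.AcSelmer

end
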